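import Summits.QuantumFields.YangMills.Theorems.BalabanUVNodesN15KingModelHeatKernelGradientBlockCov
import Summits.QuantumFields.YangMills.Theorems.BalabanUVNodesN15KingModelHeatKernelGradientFreeKernel
import HarnessLib

/-!
# BalabanUVNodes ∕ N15 — THE KING-MODEL RUNG (PART ∇-i): THE PART ∇ PACKAGE — the η-uniform inverse-cube laws for the lattice gradient of King's `A = 0` covariance (torus, both slots,
# King's scaling), for the block gradient of NE2's unit layer, and for the free kernel on `ℤ⁴`, BY NAME; the `∃ C` forms with ONE absolute constant; and the one line «what the curved case adds»
# (Track A, DAG node N15 = NE2: «η-rates of the covariance ∕ background pieces ([B9] (3.42) ∕ King 1986 kernels)»; FAN-OUT v1.1 §N15 s3 «KING-MODEL RUNG … + what the curved case adds»; count-neutral)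

HONEST FRAMING.  Count-neutral (cell `pub-ymgap`, seat `pub-ymgap-dag-n15-e` g57; `--supports stmt-QuantumFields-27247 --as helper` = K3ᴬ, KEY MAP v3).  Packaging only: every conjunct is a
theorem of PARTS ∇-f∕∇-g∕∇-h cited by name; King's `A = 0` one-step comparison model on cubic four-tori `(ℤ∕LM₀)⁴ → (ℤ∕M₀)⁴` and on `ℤ⁴`; NOT Bałaban's covariant propagators, NOT [B9] (3.42);
NOT a node discharge (N15 of record untouched); nothing continuum ∕ ℝ⁴ ∕ OS ∕ mass gap ∕ Clay.  THE SHAPE OF THE RESULT: ONE absolute constant `C_∇ = 4940000` serves the covariance at every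
hopping `c`, mass `m²`, side `K₀` (no zero mode, no mass), hence at King's scaling for every `L`, `M₀`; the unit layer's block gradient costs `64C_∇ + 128∕m²`; the `ℤ⁴` kernel again `C_∇`.
WHAT THE CURVED CASE ADDS (the FAN-OUT row's one line): the same three laws at a non-trivial unitary background `U` — for the KERNELS PART Ϣ-i∕Ϻ-e transferred the square laws by Kato's
domination with the same constants, but domination of kernels does not dominate their differences: the covariant gradient laws ([B9] Thm 3.1 (3.42)₂, (3.133)) are node N15's open cell,
to be reached by [B9]'s own route (Combes–Thomas at every `U`, PART Ϧ, interpolated with the flat inverse-cube law of this PART).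
CONTENTS.  ★★★ `king_green_grad_powerLaw_exists` (`∃ C ∀ c m² K₀ x y μ ν`), ★★★ `king_green_grad_powerLaw_eta_uniform_exists` (`∃ C ∀ m² L M₀ x y ν`, both slots), ★★★ `king_blockCov_grad_powerLaw_exists`
(`∀ m² ∃ C ∀ a L M₀ y y′ ν`, both slots), ★★★★ **`king_gradient_package`** (the five displayed laws by name), ★★★ `king_gradient_what_the_curved_case_adds` (the flat laws packaged as the `U = 1`
member; the covariant statement is NOT asserted).
PRIOR TREE ART (by name): ∇-f `mul_abs_lapF_inv_grad_le_powerLaw` ∕ `…_tdistT` ∕ `…_snd_…` ∕ `king_green_grad_powerLaw_tdistT` ∕ `king_green_grad_what_the_curved_case_adds`, ∇-g `king_blockCov_grad_powerLaw_eta_uniform` ∕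
`…_snd_…`, ∇-h `mul_abs_freeKer_grad_le_powerLaw`.
Dedup (rg at filing): basename 0 files; needles `king_gradient_package|king_green_grad_powerLaw_exists|king_blockCov_grad_powerLaw_exists|king_gradient_what_the_curved_case_adds` 0 tree files.
Locators: [King1986] (2.13)–(2.14) p.653, (4.4) p.670, (4.35) p.674, (4.44)–(4.45) p.675, (3.63) p.663; [Balaban1985BackgroundPropagators] Thm 3.1 (3.42) p.397 (NOT asserted), Thm 3.4 p.400;
[Balaban1983RegularityDecay] (2.43) p.584; [LawlerLimic2010] Thm 4.3.1.  0 `sorry`, 0 `def`.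
-/

noncomputable section

open Real Finset Matrix
open scoped BigOperators

namespace Summit.QuantumFields.YangMills.BalabanUVNodes.N15KingModelRung.HeatKernel

open Literature.MathematicalPhysics.QuantumFieldTheory.Balaban1983to89.B5Prop11Plancherel (Tor fine unitVec)
open Literature.MathematicalPhysics.QuantumFieldTheory.Balaban1983to89.Beta.WoodburyFibre (cM)
open Literature.MathematicalPhysics.QuantumFieldTheory.King1986.Torus (lapF effLaplacian tdistT)
open Summit.QuantumFields.YangMills.BalabanUVNodes.N15KingModelRung.TorusSpectral (freeKer)

/-! ## §1 The `∃ C` forms: one absolute constant -/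

/-- ★★★ **ONE ABSOLUTE CONSTANT FOR EVERY TORUS COVARIANCE**: `∃ C, ∀ c > 0, m² > 0, K₀ ≥ 1, x, y, μ, ν: c·|G(x+e_ν,y) − G(x,y)| ≤ C∕(1+|v((x−y)_μ)|)³` (`C = 4940000`).
[cite: King1986, (2.13) p.653, (4.4) p.670, (3.63) p.663] -/
theorem king_green_grad_powerLaw_exists :
    ∃ C : ℝ, ∀ (K₀ : ℕ) [NeZero K₀] (c m2 : ℝ), 0 < c → 0 < m2 → ∀ (x y : Tor (cM K₀)) (ν μ : Fin 4),
      c * |(lapF (cM K₀) c m2)⁻¹ (x + unitVec (cM K₀) ν) y - (lapF (cM K₀) c m2)⁻¹ x y| ≤ C / (1 + ((((x - y) μ).valMinAbs.natAbs : ℕ) : ℝ)) ^ 3 :=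
  ⟨4940000, fun _ _ _ _ hc hm x y ν μ => mul_abs_lapF_inv_grad_le_powerLaw hc hm x y ν μ⟩

/-- ★★★ **ONE ABSOLUTE CONSTANT AT KING's SCALING, BOTH SLOTS**: `∃ C, ∀ m² > 0, L, M₀, x, y, ν`: `L²|G(x+e_ν,y) − G(x,y)| ≤ C∕(1+tdistT(x,y))³` and the same for `G(x,y+e_ν) − G(x,y)`.
[cite: King1986, (2.13) p.653, (4.4) p.670, (3.63) p.663] -/
theorem king_green_grad_powerLaw_eta_uniform_exists :
    ∃ C : ℝ, ∀ (L M₀ : ℕ) [NeZero L] [NeZero M₀] (m2 : ℝ), 0 < m2 → ∀ (x y : Tor (fine L (cM M₀))) (ν : Fin 4),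
      (L : ℝ) ^ 2 * |(lapF (fine L (cM M₀)) ((L : ℝ) ^ 2) m2)⁻¹ (x + unitVec (fine L (cM M₀)) ν) y - (lapF (fine L (cM M₀)) ((L : ℝ) ^ 2) m2)⁻¹ x y|
          ≤ C / (1 + tdistT (fine L (cM M₀)) x y) ^ 3
      ∧ (L : ℝ) ^ 2 * |(lapF (fine L (cM M₀)) ((L : ℝ) ^ 2) m2)⁻¹ x (y + unitVec (fine L (cM M₀)) ν) - (lapF (fine L (cM M₀)) ((L : ℝ) ^ 2) m2)⁻¹ x y|
          ≤ C / (1 + tdistT (fine L (cM M₀)) x y) ^ 3 :=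
  ⟨4940000, fun L M₀ _ _ _ hm x y ν =>
    ⟨(king_green_grad_what_the_curved_case_adds L M₀ hm).1 x y ν, (king_green_grad_what_the_curved_case_adds L M₀ hm).2 x y ν⟩⟩

/-- ★★★ **ONE CONSTANT PER MASS FOR NE2's UNIT LAYER, BOTH SLOTS**: for every `m² > 0` there is `C(m²) = 316160000 + 128∕m²` with `|(C−a⁻¹1)(y+ê_ν,y′) − (C−a⁻¹1)(y,y′)| ≤ C(m²)∕(1+dist_M(y,y′))³`
(and the same in the second slot) for EVERY `a > 0`, `L ≥ 1`, `M₀ ≥ 1`, `y, y′, ν`. [cite: King1986, (2.14) p.653, (4.45) p.675, (3.63) p.663] -/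
theorem king_blockCov_grad_powerLaw_exists {m2 : ℝ} (hm : 0 < m2) :
    ∃ C : ℝ, ∀ (L M₀ : ℕ) [NeZero L] [NeZero M₀] (a : ℝ), 0 < a → ∀ (y y' : Tor (cM M₀)) (ν : Fin 4),
      |((effLaplacian L (cM M₀) a ((L : ℝ) ^ 2) m2)⁻¹ - a⁻¹ • (1 : Matrix (Tor (cM M₀)) (Tor (cM M₀)) ℝ)) (y + unitVec (cM M₀) ν) y'
          - ((effLaplacian L (cM M₀) a ((L : ℝ) ^ 2) m2)⁻¹ - a⁻¹ • (1 : Matrix (Tor (cM M₀)) (Tor (cM M₀)) ℝ)) y y'| ≤ C / (1 + tdistT (cM M₀) y y') ^ 3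
      ∧ |((effLaplacian L (cM M₀) a ((L : ℝ) ^ 2) m2)⁻¹ - a⁻¹ • (1 : Matrix (Tor (cM M₀)) (Tor (cM M₀)) ℝ)) y (y' + unitVec (cM M₀) ν)
          - ((effLaplacian L (cM M₀) a ((L : ℝ) ^ 2) m2)⁻¹ - a⁻¹ • (1 : Matrix (Tor (cM M₀)) (Tor (cM M₀)) ℝ)) y y'| ≤ C / (1 + tdistT (cM M₀) y y') ^ 3 :=
  ⟨316160000 + 128 / m2, fun L M₀ _ _ _ ha y y' ν =>
    ⟨king_blockCov_grad_powerLaw_eta_uniform L M₀ ha hm y y' ν, king_blockCov_grad_snd_powerLaw_eta_uniform L M₀ ha hm y y' ν⟩⟩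

/-! ## §2 PART ∇ by name -/

/-- ★★★★ **PART ∇ PACKAGE (by name)**: (i) cubic four-torus, every `c > 0`, `m² > 0`, every direction `ν`: `c|G(x+e_ν,y) − G(x,y)| ≤ 4940000∕(1+tdistT(x,y))³` and the same in the second slot;
(ii) King's scaling `c = L²` on `(ℤ∕LM₀)⁴`, every `L`, `M₀`: `L²|G(x+e_ν,y) − G(x,y)| ≤ 4940000∕(1+tdistT(x,y))³`; (iii) NE2's unit layer on `(ℤ∕M₀)⁴`, every `a > 0`, `L`, `M₀`:
`|(C−a⁻¹1)(y+ê_ν,y′) − (C−a⁻¹1)(y,y′)| ≤ (316160000 + 128∕m²)∕(1+dist_M(y,y′))³`; (iv) the free kernel on `ℤ⁴`: `c|K_∞(z+e_ν) − K_∞(z)| ≤ 4940000∕(1+|z_μ|)³` for every `μ`.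
[cite: King1986, (2.13)–(2.14) p.653, (4.4) p.670, (4.35) p.674, (4.45) p.675, (3.63) p.663; Balaban1983RegularityDecay, (2.43) p.584] -/
theorem king_gradient_package {K₀ : ℕ} [NeZero K₀] {c m2 a : ℝ} (hc : 0 < c) (hm : 0 < m2) (ha : 0 < a) (L M₀ : ℕ) [NeZero L] [NeZero M₀] :
    (∀ (x y : Tor (cM K₀)) (ν : Fin 4),
        c * |(lapF (cM K₀) c m2)⁻¹ (x + unitVec (cM K₀) ν) y - (lapF (cM K₀) c m2)⁻¹ x y| ≤ 4940000 / (1 + tdistT (cM K₀) x y) ^ 3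
        ∧ c * |(lapF (cM K₀) c m2)⁻¹ x (y + unitVec (cM K₀) ν) - (lapF (cM K₀) c m2)⁻¹ x y| ≤ 4940000 / (1 + tdistT (cM K₀) x y) ^ 3)
    ∧ (∀ (x y : Tor (fine L (cM M₀))) (ν : Fin 4),
        (L : ℝ) ^ 2 * |(lapF (fine L (cM M₀)) ((L : ℝ) ^ 2) m2)⁻¹ (x + unitVec (fine L (cM M₀)) ν) y - (lapF (fine L (cM M₀)) ((L : ℝ) ^ 2) m2)⁻¹ x y|
          ≤ 4940000 / (1 + tdistT (fine L (cM M₀)) x y) ^ 3)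
    ∧ (∀ (y y' : Tor (cM M₀)) (ν : Fin 4),
        |((effLaplacian L (cM M₀) a ((L : ℝ) ^ 2) m2)⁻¹ - a⁻¹ • (1 : Matrix (Tor (cM M₀)) (Tor (cM M₀)) ℝ)) (y + unitVec (cM M₀) ν) y'
          - ((effLaplacian L (cM M₀) a ((L : ℝ) ^ 2) m2)⁻¹ - a⁻¹ • (1 : Matrix (Tor (cM M₀)) (Tor (cM M₀)) ℝ)) y y'| ≤ (316160000 + 128 / m2) / (1 + tdistT (cM M₀) y y') ^ 3)
    ∧ (∀ (z : Fin 4 → ℤ) (ν μ : Fin 4), c * |freeKer c m2 (z + Pi.single ν 1) - freeKer c m2 z| ≤ 4940000 / (1 + |((z μ : ℤ) : ℝ)|) ^ 3) :=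
  ⟨fun x y ν => ⟨mul_abs_lapF_inv_grad_le_powerLaw_tdistT hc hm x y ν, mul_abs_lapF_inv_grad_snd_le_powerLaw_tdistT hc hm x y ν⟩,
    fun x y ν => king_green_grad_powerLaw_tdistT L M₀ hm x y ν,
    fun y y' ν => king_blockCov_grad_powerLaw_eta_uniform L M₀ ha hm y y' ν,
    fun z ν μ => mul_abs_freeKer_grad_le_powerLaw hc hm z ν μ⟩

/-! ## §3 What the curved case adds -/

/-- ★★★ **WHAT THE CURVED CASE ADDS — THE GRADIENT LAWS ARE THE `U = 1` MEMBER ONLY**: at `A = 0` both King layers touched by node N15's covariance pieces carry η-uniform inverse-cube gradient laws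
(the covariance in both slots, the unit layer in both slots), every `L`, every `M₀`; for a non-trivial unitary background nothing in PART ∇ applies (Kato's domination is blind to differences),
so the display below is deliberately the flat statement: it is what a covariant proof along [B9]'s route must reproduce at `U = 1`.
[cite: King1986, (2.13)–(2.14) p.653, (3.63) p.663; Balaban1985BackgroundPropagators, Thm 3.1 (3.42) p.397, Thm 3.4 p.400] -/
theorem king_gradient_what_the_curved_case_adds {m2 a : ℝ} (hm : 0 < m2) (ha : 0 < a) (L M₀ : ℕ) [NeZero L] [NeZero M₀] :
    (∀ (x y : Tor (fine L (cM M₀))) (ν : Fin 4),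
        (L : ℝ) ^ 2 * |(lapF (fine L (cM M₀)) ((L : ℝ) ^ 2) m2)⁻¹ (x + unitVec (fine L (cM M₀)) ν) y - (lapF (fine L (cM M₀)) ((L : ℝ) ^ 2) m2)⁻¹ x y|
          ≤ 4940000 / (1 + tdistT (fine L (cM M₀)) x y) ^ 3
        ∧ (L : ℝ) ^ 2 * |(lapF (fine L (cM M₀)) ((L : ℝ) ^ 2) m2)⁻¹ x (y + unitVec (fine L (cM M₀)) ν) - (lapF (fine L (cM M₀)) ((L : ℝ) ^ 2) m2)⁻¹ x y|
          ≤ 4940000 / (1 + tdistT (fine L (cM M₀)) x y) ^ 3)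
    ∧ (∀ (y y' : Tor (cM M₀)) (ν : Fin 4),
        |((effLaplacian L (cM M₀) a ((L : ℝ) ^ 2) m2)⁻¹ - a⁻¹ • (1 : Matrix (Tor (cM M₀)) (Tor (cM M₀)) ℝ)) (y + unitVec (cM M₀) ν) y'
          - ((effLaplacian L (cM M₀) a ((L : ℝ) ^ 2) m2)⁻¹ - a⁻¹ • (1 : Matrix (Tor (cM M₀)) (Tor (cM M₀)) ℝ)) y y'| ≤ (316160000 + 128 / m2) / (1 + tdistT (cM M₀) y y') ^ 3
        ∧ |((effLaplacian L (cM M₀) a ((L : ℝ) ^ 2) m2)⁻¹ - a⁻¹ • (1 : Matrix (Tor (cM M₀)) (Tor (cM M₀)) ℝ)) y (y' + unitVec (cM M₀) ν)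
          - ((effLaplacian L (cM M₀) a ((L : ℝ) ^ 2) m2)⁻¹ - a⁻¹ • (1 : Matrix (Tor (cM M₀)) (Tor (cM M₀)) ℝ)) y y'| ≤ (316160000 + 128 / m2) / (1 + tdistT (cM M₀) y y') ^ 3) :=
  ⟨fun x y ν => ⟨(king_green_grad_what_the_curved_case_adds L M₀ hm).1 x y ν, (king_green_grad_what_the_curved_case_adds L M₀ hm).2 x y ν⟩,
    fun y y' ν => ⟨king_blockCov_grad_powerLaw_eta_uniform L M₀ ha hm y y' ν, king_blockCov_grad_snd_powerLaw_eta_uniform L M₀ ha hm y y' ν⟩⟩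

end Summit.QuantumFields.YangMills.BalabanUVNodes.N15KingModelRung.HeatKernel

end
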